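import Literature.RingTheory.MvPolynomial.CubicFormPlaneChains
import Literature.AlgebraicGeometry.Resolution.RegularLocalRingsJacobian
import Mathlib.RingTheory.MvPolynomial.EulerIdentity
import Mathlib.Algebra.Polynomial.Roots

/-!
# Two planes of a smooth cubic meeting in a line span a `3`-plane not on the cubic

For a cubic form `F` on `kᴺ⁺¹` (`k` algebraically closed, `N ≥ 12`) whose gradient vanishes at no
non-zero zero of `F` (the projective hypersurface `X = V₊(F)` is smooth, by the Jacobian
criterion), **there are two isotropic `3`-spaces `U₁ = span(a, b, y)`, `U₂ = span(a, b, w)`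
(`F ≡ 0` on each) meeting in the `2`-space `span(a, b)` whose sum `span(a, b, y, w)` is NOT
isotropic** (`exists_nonIsotropic_plane_pair`): two planes `ℙ(U₁), ℙ(U₂) ⊆ X` meeting in a line
and spanning a `3`-plane `M ⊄ X`, so that `X ∩ M` is the union of three planes (the third one
residual; `Motives/HypersurfaceSplitLinearSections`, `Hypersurface.exists_residual_plane_of_cubic`)
and the class `H_X^{dim X - 2} ∩ [X] = [X ∩ M]` is a sum of plane classes — the input
"`𝒫 ∈ Im(P_*)`", "`H_X^{n-2} ∈ Im(P_*)`" of R. Mboro, *Remarks on the `CH₂` of cubic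
hypersurfaces* (arXiv:1701.04488), Prop. 1.4 and proof of Thm. 1.3, in the elementary form used by
`Motives/CubicThreePlaneSectionPlanes`.

Proof (elementary; folklore linear algebra of cubic forms).
* If NO such pair exists, then any isotropic `W ⊇ L = span(a, b)` and any `y ∉ W` with `L + ky`
  isotropic give `W + ky` isotropic (apply the hypothesis to `span(a, b, y)` and `span(a, b, w)`
  for `w ∈ W ∖ L`), so the greedy construction (`exists_eval_eq_zero_escaping`: `6` coefficient
  conditions and `dim W` escape conditions, solvable while `6 + dim W < N + 1`,
  `Literature.RingTheory.KrullDimension.exists_ne_zero_common_zero_of_isHomogeneous`) produces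
  isotropic subspaces of every dimension up to `N - 5` (`exists_isotropic_of_noPair`).
* But on an isotropic subspace `W` with `2 dim W > N + 1` the cubic has a singular zero
  (`exists_ne_zero_pderiv_eval_eq_zero_of_isotropic`): the derivatives of `F` along `W` vanish on
  `W` (`F ≡ 0` there; first-order Taylor expansion,
  `sum_mul_eval_pderiv_eq_zero_of_forall_eval_add_smul`), and the derivatives along
  `N + 1 - dim W < dim W` complementary directions are quadratic forms on `W` with a common non-zero
  zero. For `N ≥ 12`, `2 (N - 5) > N + 1`.

Everything is proved; no definitions, no named facts.

## References

* [Mboro2018] R. Mboro, Remarks on the CH₂ of cubic hypersurfaces, arXiv:1701.04488, Prop. 1.4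
  and proof of Thm. 1.3 (p. 8).
* [Hartshorne1977] R. Hartshorne, Algebraic Geometry (1977), I Thm. 5.1 and Ex. 5.8 (Jacobian
  criterion; first-order Taylor expansion).
* [Shatz1972] S. S. Shatz, Profinite groups, arithmetic, and geometry (1972), Ch. IV §3 (projective
  dimension theorem, via `exists_ne_zero_common_zero_of_isHomogeneous`).
-/

noncomputable section

open _root_.MvPolynomial

namespace Literature.RingTheory.MvPolynomial

universe u

variable {k : Type u} [Field k] {N : ℕ}

/-! ### Derivatives along an isotropic direction vanish (first-order Taylor expansion) -/

section Taylor

/-- **If `f(a + t v) = 0` for all `t` then `Σ_i v_i ∂f/∂x_i (a) = 0`** (`k` infinite): the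
polynomial `t ↦ f(a + t v)` vanishes identically, and its coefficient of `t` is the directional
derivative, by the first-order Taylor expansion `f ≡ f(a) + Σ_i ∂f/∂x_i(a) (x_i - a_i) mod 𝔞_a²`
(`Resolution.sub_taylor_mem_ker_eval_sq`, Hartshorne I Thm. 5.1). [cite: Hartshorne1977, I Thm. 5.1 (proof)] -/
theorem sum_mul_eval_pderiv_eq_zero_of_forall_eval_add_smul [Infinite k] {σ : Type*} [Fintype σ]
    [DecidableEq σ] (f : MvPolynomial σ k) (a v : σ → k) (h : ∀ t : k, eval (a + t • v) f = 0) :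
    ∑ i, v i * eval a (pderiv i f) = 0 := by
  classical
  -- the restriction to the line, `ψ g = g(a + T v) ∈ k[T]`
  let ψ : MvPolynomial σ k →ₐ[k] Polynomial k :=
    aeval fun i => Polynomial.C (a i) + Polynomial.C (v i) * Polynomial.X
  have hψC : ∀ c : k, ψ (C c) = Polynomial.C c := fun c => by
    simp only [ψ, algHom_C, Polynomial.algebraMap_eq]
  have hψX : ∀ i, ψ (X i) = Polynomial.C (a i) + Polynomial.C (v i) * Polynomial.X := fun i => by
    simp only [ψ, aeval_X]
  have hψt : ∀ (t : k) (g : MvPolynomial σ k), (ψ g).eval t = eval (a + t • v) g := by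
    intro t g
    have hext : (Polynomial.evalRingHom t).comp (ψ : MvPolynomial σ k →+* Polynomial k) = eval (a + t • v) := by
      refine MvPolynomial.ringHom_ext (fun c => ?_) (fun i => ?_)
      · rw [RingHom.comp_apply, RingHom.coe_coe, hψC, Polynomial.coe_evalRingHom, Polynomial.eval_C,
          eval_C]
      · rw [RingHom.comp_apply, RingHom.coe_coe, hψX, Polynomial.coe_evalRingHom, eval_X]
        simp only [Polynomial.eval_add, Polynomial.eval_C, Polynomial.eval_mul, Polynomial.eval_X,
          Pi.add_apply, Pi.smul_apply, smul_eq_mul]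
        ring
    exact (DFunLike.congr_fun hext g :)
  -- `ψ f = 0` and `f(a) = 0`
  have hψf : ψ f = 0 := by
    apply Polynomial.eq_zero_of_infinite_isRoot
    refine Set.infinite_univ.mono fun t _ => ?_
    change (ψ f).IsRoot t
    rw [Polynomial.IsRoot.def, hψt, h t]
  have hfa : eval a f = 0 := by
    have h0 := h 0
    rwa [zero_smul, add_zero] at h0
  -- `ψ (𝔞_a) ⊆ (T)`, hence `ψ (𝔞_a²) ⊆ (T²)`
  have hker : Ideal.map (ψ : MvPolynomial σ k →+* Polynomial k) (RingHom.ker (eval a)) ≤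
      Ideal.span {(Polynomial.X : Polynomial k)} := by
    rw [Ideal.map_le_iff_le_comap]
    intro g hg
    rw [Ideal.mem_comap, Ideal.mem_span_singleton, Polynomial.X_dvd_iff, RingHom.coe_coe,
      Polynomial.coeff_zero_eq_eval_zero, hψt, zero_smul, add_zero]
    exact (RingHom.mem_ker).1 hg
  have hker2 : Ideal.map (ψ : MvPolynomial σ k →+* Polynomial k) (RingHom.ker (eval a) ^ 2) ≤
      Ideal.span {(Polynomial.X ^ 2 : Polynomial k)} := by
    rw [Ideal.map_pow, ← Ideal.span_singleton_pow]
    exact Ideal.pow_right_mono hker 2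
  -- apply `ψ` to the Taylor expansion
  have htay := Ideal.mem_map_of_mem (ψ : MvPolynomial σ k →+* Polynomial k)
    (Literature.AlgebraicGeometry.Resolution.sub_taylor_mem_ker_eval_sq a f)
  have hmem := hker2 htay
  rw [Ideal.mem_span_singleton, Polynomial.X_pow_dvd_iff] at hmem
  have h1 := hmem 1 (by norm_num)
  rw [RingHom.coe_coe, map_sub, map_sub, map_sum, hψf, hψC, hfa, Polynomial.C_0, sub_zero, zero_sub,
    Polynomial.coeff_neg, neg_eq_zero, Polynomial.finsetSum_coeff] at h1
  rw [← h1]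
  refine Finset.sum_congr rfl fun i _ => ?_
  rw [map_mul, hψC, map_sub, hψX, hψC, add_sub_cancel_left, ← mul_assoc, ← Polynomial.C_mul,
    Polynomial.coeff_C_mul, Polynomial.coeff_X_one, mul_one, mul_comm]

end Taylor

/-! ### The greedy step, escaping a larger frame -/

section Escape

variable {u m : ℕ}

/-- **The greedy step with separate escape frame.** Let `F` be a cubic form on `kᴺ⁺¹`, `k`
algebraically closed, vanishing identically on the span of `u` vectors `w₀, …, w_{u-1}`, and let
`e₀, …, e_{m-1}` be linearly independent. If `#{s-monomials of degree ≤ 2 in u variables} + m <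
N + 1`, there is a vector `y ∉ span(e)` such that `F` vanishes identically on `span(w) + k y`
(as in `exists_finCons_eval_eq_zero`, the coefficients `coeff_α F(Σ_j s_j w_j + y)`, `|α| ≤ 2`,
and the `m` coordinates of `y` along the `e_j` are forms of positive degree, fewer than `N + 1`
of them). [folklore] -/
theorem exists_eval_eq_zero_escaping [IsAlgClosed k] {F : MvPolynomial (Fin (N + 1)) k}
    (hF : F.IsHomogeneous 3) (w : Fin u → Fin (N + 1) → k) {e : Fin m → Fin (N + 1) → k}
    (he : LinearIndependent k e)
    (hvan : ∀ c : Fin u → k, eval (fun x => ∑ j, c j * w j x) F = 0)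
    (hN : (Finset.univ.filter (fun f : Fin u → Fin 3 => ∑ j, (f j : ℕ) ≤ 2)).card + m < N + 1) :
    ∃ y : Fin (N + 1) → k, y ∉ Submodule.span k (Set.range e) ∧
      ∀ (c : Fin u → k) (t : k), eval (fun x => (∑ j, c j * w j x) + t * y x) F = 0 := by
  classical
  -- the substituted form `P = F(Σ_j s_j w_j + y)` and its bihomogeneity
  set P : MvPolynomial (Fin u) (MvPolynomial (Fin (N + 1)) k) :=
    aeval (fun x : Fin (N + 1) =>
      (∑ j : Fin u, C (C (w j x)) * X j) + C (X x) :
        Fin (N + 1) → MvPolynomial (Fin u) (MvPolynomial (Fin (N + 1)) k)) F with hP_def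
  have hP : ∀ α, (coeff α P).IsHomogeneous (3 - α.degree) ∧ (3 < α.degree → coeff α P = 0) := by
    refine isBihom_aeval hF _ fun x => ?_
    refine isBihom_add (isBihom_sum _ _ fun j _ => ?_)
      (isBihom_C_of_isHomogeneous_one (isHomogeneous_X k x))
    simpa using isBihom_mul (isBihom_C_C (σ := Fin u) (τ := Fin (N + 1)) (w j x))
      (isBihom_X (k := k) (τ := Fin (N + 1)) j)
  -- a retraction `ψ` of `c ↦ Σ_j c_j e_j`
  have hinj : Function.Injective (Fintype.linearCombination k e) :=
    linearIndependent_iff_injective_fintypeLinearCombination.mp he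
  obtain ⟨ψ, hψ⟩ := LinearMap.exists_leftInverse_of_injective _ (LinearMap.ker_eq_bot.mpr hinj)
  -- the system of conditions: coefficients of `s`-degree `< 3` and the escape forms
  set S : Finset (Fin u →₀ ℕ) := P.support.filter (fun α => α.degree < 3) with hS_def
  have hS3 : ∀ α ∈ S, α.degree < 3 := fun α hα => (Finset.mem_filter.mp hα).2
  let g : ↥S ⊕ Fin m → MvPolynomial (Fin (N + 1)) k :=
    Sum.elim (fun α => coeff α.1 P) (fun j => ∑ x : Fin (N + 1), C (ψ (Pi.single x 1) j) * X x)
  let deg : ↥S ⊕ Fin m → ℕ := Sum.elim (fun α => 3 - α.1.degree) (fun _ => 1)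
  have hg : ∀ i, (g i).IsHomogeneous (deg i) := by
    rintro (α | j)
    · exact (hP α.1).1
    · exact isHomogeneous_escapeForm ψ j
  have hdeg : ∀ i, 0 < deg i := by
    rintro (α | j)
    · have := hS3 α.1 α.2
      change 0 < 3 - α.1.degree
      omega
    · exact Nat.one_pos
  have hcard : Fintype.card (↥S ⊕ Fin m) < N + 1 := by
    rw [Fintype.card_sum, Fintype.card_coe, Fintype.card_fin]
    exact lt_of_le_of_lt (Nat.add_le_add_right (card_le_of_degree_lt_three S hS3) m) hN
  obtain ⟨y, hy0, hy⟩ :=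
    Literature.RingTheory.KrullDimension.exists_ne_zero_common_zero_of_isHomogeneous g deg hg hdeg
      hcard
  have hyS : ∀ α ∈ P.support, α.degree < 3 → eval y (coeff α P) = 0 := fun α hα hd =>
    hy (Sum.inl ⟨α, Finset.mem_filter.mpr ⟨hα, hd⟩⟩)
  have hyψ : ψ y = 0 := by
    ext j
    rw [← eval_escapeForm ψ j y]
    exact hy (Sum.inr j)
  have hy_span : y ∉ Submodule.span k (Set.range e) := by
    intro hmem
    rw [← Fintype.range_linearCombination] at hmem
    obtain ⟨c, rfl⟩ := hmem
    have hc : ψ (Fintype.linearCombination k e c) = c := by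
      have := LinearMap.congr_fun hψ c
      simpa using this
    have hc0 : c = 0 := hc.symm.trans hyψ
    exact hy0 (by rw [hc0, map_zero])
  refine ⟨y, hy_span, fun c t => ?_⟩
  -- `F` vanishes on `span(w) + k y`
  have key := eval_eval_smul_eq_of_isBihom hP hyS c t
  rw [hP_def, eval_eval_aeval_lin, eval_eval_aeval_lin] at key
  have h0 : eval (fun x => (∑ j, c j * w j x) + (0 : Fin (N + 1) → k) x) F = 0 := by
    simpa using hvan c
  rw [h0] at key
  have hfun : (fun x => (∑ j, c j * w j x) + t * y x) = fun x => (∑ j, c j * w j x) + (t • y) x := by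
    ext x
    simp only [Pi.smul_apply, smul_eq_mul]
  rw [hfun]
  exact key

end Escape

/-! ### Without a non-isotropic pair the greedy construction never stops -/

section NoPair

variable {F : MvPolynomial (Fin (N + 1)) k}

/-- `![a, b, y, w] = snoc (snoc ![a, b] y) w`. [folklore] -/
theorem vecCons_four_eq_snoc_snoc {V : Type*} (a b y w : V) :
    (![a, b, y, w] : Fin 4 → V) = Fin.snoc (Fin.snoc ![a, b] y) w := by
  ext i
  fin_cases i <;> rfl

/-- **The induction step.** Let `F` be a cubic form on `kᴺ⁺¹` (`k` algebraically closed) such that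
for all linearly independent `a, b, y, w` with `F ≡ 0` on `span(a, b, y)` and on `span(a, b, w)`
also `F ≡ 0` on `span(a, b, y, w)` (no non-isotropic plane pair). Then every isotropic subspace
`W` of dimension `D ≥ 2` with `6 + D < N + 1` lies in an isotropic subspace of dimension `D + 1`:
for a frame `e` of `W` and `y ∉ W` with `span(e₀, e₁) + ky` isotropic
(`exists_eval_eq_zero_escaping`), `W + ky` is isotropic — a vector `t y + w`, `w ∈ W`, lies in
`span(e₀, e₁, y)` if `w ∈ span(e₀, e₁)` and in `span(e₀, e₁, y, w)` otherwise. [folklore] -/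
theorem exists_isotropic_succ_of_noPair [IsAlgClosed k] (hF : F.IsHomogeneous 3)
    (hpair : ∀ a b y w : Fin (N + 1) → k, LinearIndependent k ![a, b, y, w] →
      (∀ v ∈ Submodule.span k (Set.range ![a, b, y]), eval v F = 0) →
      (∀ v ∈ Submodule.span k (Set.range ![a, b, w]), eval v F = 0) →
      ∀ v ∈ Submodule.span k (Set.range ![a, b, y, w]), eval v F = 0)
    {W : Submodule k (Fin (N + 1) → k)} {D : ℕ} (hW : Module.finrank k W = D) (hD : 2 ≤ D)
    (hDN : 6 + D < N + 1) (hiso : ∀ v ∈ W, eval v F = 0) :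
    ∃ W' : Submodule k (Fin (N + 1) → k), W ≤ W' ∧ Module.finrank k W' = D + 1 ∧
      ∀ v ∈ W', eval v F = 0 := by
  classical
  obtain ⟨e, he, hspan⟩ := exists_frame_of_finrank_eq hW
  -- the sub-frame `e₀, e₁` and its span `L`
  let i0 : Fin D := ⟨0, by omega⟩
  let i1 : Fin D := ⟨1, by omega⟩
  have h01 : i0 ≠ i1 := by simp [i0, i1, Fin.ext_iff]
  let ab : Fin 2 → Fin (N + 1) → k := ![e i0, e i1]
  have hab_mem : ∀ j, ab j ∈ W := by
    intro j
    rw [← hspan]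
    fin_cases j
    · exact Submodule.subset_span ⟨i0, rfl⟩
    · exact Submodule.subset_span ⟨i1, rfl⟩
  have hab : LinearIndependent k ab := by
    have h : ab = e ∘ ![i0, i1] := by
      ext j x; fin_cases j <;> rfl
    rw [h]
    refine he.comp _ fun j j' hjj' => ?_
    fin_cases j <;> fin_cases j'
    · rfl
    · exact absurd hjj' h01
    · exact absurd hjj'.symm h01
    · rfl
  have hvan : ∀ c : Fin 2 → k, eval (fun x => ∑ j, c j * ab j x) F = 0 := by
    intro c
    rw [sum_mul_apply_eq_sum_smul]
    exact hiso _ (Submodule.sum_mem _ fun j _ => Submodule.smul_mem _ _ (hab_mem j))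
  -- the greedy step: `y ∉ W` with `span(e₀, e₁) + ky` isotropic
  obtain ⟨y, hyW, hy⟩ := exists_eval_eq_zero_escaping hF ab he hvan
    (by rw [card_filter_fin_two]; omega)
  rw [hspan] at hyW
  have hLy : ∀ v ∈ Submodule.span k (Set.range ab), ∀ t : k, eval (t • y + v) F = 0 := by
    intro v hv t
    obtain ⟨c, rfl⟩ := (Submodule.mem_span_range_iff_exists_fun k).1 hv
    have h := hy c t
    have hfun : (fun x => (∑ j, c j * ab j x) + t * y x) = t • y + ∑ j, c j • ab j := by
      funext x
      simp only [Pi.add_apply, Pi.smul_apply, smul_eq_mul, Finset.sum_apply]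
      ring
    rwa [hfun] at h
  -- `W' = W + ky`
  refine ⟨W ⊔ k ∙ y, le_sup_left, ?_, ?_⟩
  · have h := Submodule.finrank_sup_add_finrank_inf_eq W (k ∙ y)
    have hinf : W ⊓ (k ∙ y) = ⊥ := by
      rw [eq_bot_iff]
      intro v hv
      obtain ⟨hvW, hvy⟩ := Submodule.mem_inf.1 hv
      obtain ⟨t, rfl⟩ := Submodule.mem_span_singleton.1 hvy
      by_cases ht : t = 0
      · rw [ht, zero_smul]; exact Submodule.zero_mem _
      · exfalso
        apply hyW
        have : y = t⁻¹ • (t • y) := by rw [smul_smul, inv_mul_cancel₀ ht, one_smul]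
        rw [this]
        exact W.smul_mem _ hvW
    have hy0 : y ≠ 0 := fun h0 => hyW (h0 ▸ Submodule.zero_mem _)
    rw [hinf, finrank_bot, add_zero, hW, finrank_span_singleton hy0] at h
    exact h
  · intro v hv
    obtain ⟨w, hw, z, hz, rfl⟩ := Submodule.mem_sup.1 hv
    obtain ⟨t, rfl⟩ := Submodule.mem_span_singleton.1 hz
    rw [add_comm w (t • y)]
    by_cases hwL : w ∈ Submodule.span k (Set.range ab)
    · exact hLy w hwL t
    · -- the frame `e₀, e₁, y, w`
      have h3 : LinearIndependent k (Fin.snoc ab y) := by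
        rw [linearIndependent_finSnoc]
        exact ⟨hab, fun h => hyW (Submodule.span_mono (by
          rintro _ ⟨j, rfl⟩; exact hab_mem j) h |> fun h' => by rwa [Submodule.span_eq] at h')⟩
      have h4 : LinearIndependent k (Fin.snoc (Fin.snoc ab y) w) := by
        rw [linearIndependent_finSnoc]
        refine ⟨h3, fun hmem => hwL ?_⟩
        rw [Fin.range_snoc, Submodule.mem_span_insert] at hmem
        obtain ⟨s, z, hz, rfl⟩ := hmem
        have hsy : s • y ∈ W := by
          have hzW : z ∈ W := Submodule.span_mono (by rintro _ ⟨j, rfl⟩; exact hab_mem j) hz |>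
            fun h' => by rwa [Submodule.span_eq] at h'
          have h := W.sub_mem hw hzW
          rwa [add_sub_cancel_right] at h
        have hs : s = 0 := by
          by_contra hs
          apply hyW
          have : y = s⁻¹ • (s • y) := by rw [smul_smul, inv_mul_cancel₀ hs, one_smul]
          rw [this]
          exact W.smul_mem _ hsy
        rw [hs, zero_smul, zero_add]
        exact hz
      have hind : LinearIndependent k ![e i0, e i1, y, w] := by
        rw [vecCons_four_eq_snoc_snoc]; exact h4
      refine hpair (e i0) (e i1) y w hind ?_ ?_ (t • y + w) ?_
      · -- `span(e₀, e₁, y)` is isotropic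
        intro v' hv'
        rw [show (![e i0, e i1, y] : Fin 3 → Fin (N + 1) → k) = Fin.snoc ab y by
          ext j x; fin_cases j <;> rfl, Fin.range_snoc, Submodule.mem_span_insert] at hv'
        obtain ⟨s, z, hz, rfl⟩ := hv'
        exact hLy z hz s
      · -- `span(e₀, e₁, w) ⊆ W` is isotropic
        intro v' hv'
        refine hiso v' (Submodule.span_le.2 ?_ hv')
        rintro _ ⟨j, rfl⟩
        fin_cases j
        · exact hab_mem 0
        · exact hab_mem 1
        · exact hw
      · exact Submodule.add_mem _ (Submodule.smul_mem _ _ (Submodule.subset_span ⟨2, rfl⟩))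
          (Submodule.subset_span ⟨3, rfl⟩)

/-- **Isotropic subspaces of every dimension up to `N - 5`** when there is no non-isotropic plane
pair (`N ≥ 8`; induction from an isotropic `3`-space, `exists_isotropic_finrank_three_ge`).
[folklore] -/
theorem exists_isotropic_of_noPair [IsAlgClosed k] (hN : 8 ≤ N) (hF : F.IsHomogeneous 3)
    (hpair : ∀ a b y w : Fin (N + 1) → k, LinearIndependent k ![a, b, y, w] →
      (∀ v ∈ Submodule.span k (Set.range ![a, b, y]), eval v F = 0) →
      (∀ v ∈ Submodule.span k (Set.range ![a, b, w]), eval v F = 0) →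
      ∀ v ∈ Submodule.span k (Set.range ![a, b, y, w]), eval v F = 0)
    {D : ℕ} (h3 : 3 ≤ D) (hDN : D + 5 ≤ N) :
    ∃ W : Submodule k (Fin (N + 1) → k), Module.finrank k W = D ∧ ∀ v ∈ W, eval v F = 0 := by
  induction D, h3 using Nat.le_induction with
  | base =>
    obtain ⟨Q, -, hQ, hisoQ⟩ := exists_isotropic_finrank_three_ge hN hF (W := ⊥)
      (by rw [finrank_bot]; omega) (fun v hv => by
        rw [(Submodule.mem_bot k).1 hv,
          show (0 : Fin (N + 1) → k) = (0 : k) • (0 : Fin (N + 1) → k) from (zero_smul k _).symm,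
          eval_smul_of_isHomogeneous hF]; simp)
    exact ⟨Q, hQ, hisoQ⟩
  | succ D hD ih =>
    obtain ⟨W, hW, hiso⟩ := ih (by omega)
    obtain ⟨W', -, hW', hiso'⟩ := exists_isotropic_succ_of_noPair hF hpair hW (by omega) (by omega) hiso
    exact ⟨W', hW', hiso'⟩

end NoPair

/-! ### A singular zero on a large isotropic subspace -/

section Singular

variable {F : MvPolynomial (Fin (N + 1)) k}

/-- **A cubic vanishing on a subspace of more than half the dimension has a singular zero on it**
(the computation behind "a smooth hypersurface of dimension `n` contains no linear subspace of
dimension `> n/2`"): on an isotropic `W` all derivatives of `F` along `W` vanish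
(`sum_mul_eval_pderiv_eq_zero_of_forall_eval_add_smul`), and the derivatives along a complement
(`N + 1 - dim W` directions) are quadratic forms on `W`; if `N + 1 - dim W < dim W` they have a
common non-zero zero `z ∈ W`, at which the whole gradient of `F` vanishes. [cite: Hartshorne1977, I Ex. 5.8] -/
theorem exists_ne_zero_pderiv_eval_eq_zero_of_isotropic [IsAlgClosed k] (hF : F.IsHomogeneous 3)
    {W : Submodule k (Fin (N + 1) → k)} {D : ℕ} (hW : Module.finrank k W = D)
    (hiso : ∀ v ∈ W, eval v F = 0) (hD : N + 1 < 2 * D) :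
    ∃ z ∈ W, z ≠ 0 ∧ ∀ j, eval z (pderiv j F) = 0 := by
  classical
  obtain ⟨e, he, hspan⟩ := exists_frame_of_finrank_eq hW
  -- a complement `W'` of `W` and a frame `u` of it
  obtain ⟨W', hWW'⟩ := Submodule.exists_isCompl W
  have hr : Module.finrank k W' = N + 1 - D := by
    have h := Submodule.finrank_add_eq_of_isCompl hWW'
    rw [hW, Module.finrank_fin_fun] at h
    omega
  obtain ⟨uv, -, huspan⟩ := exists_frame_of_finrank_eq hr
  -- the quadratic forms `Q_l(c) = Σ_j (u_l)_j ∂_j F (Σ_i c_i e_i)` on `k^D`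
  let lin : Fin (N + 1) → MvPolynomial (Fin D) k := fun x => ∑ i : Fin D, C (e i x) * X i
  have hlin : ∀ x, (lin x).IsHomogeneous 1 := fun x =>
    IsHomogeneous.sum _ _ _ fun i _ => isHomogeneous_C_mul_X _ _
  let Q : Fin (N + 1 - D) → MvPolynomial (Fin D) k :=
    fun l => aeval lin (∑ j : Fin (N + 1), C (uv l j) * pderiv j F)
  have hQ : ∀ l, (Q l).IsHomogeneous 2 := by
    intro l
    have h2 : (∑ j : Fin (N + 1), C (uv l j) * pderiv j F).IsHomogeneous 2 :=
      IsHomogeneous.sum _ _ _ fun j _ => (hF.pderiv (i := j)).C_mul _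
    have h := h2.aeval lin hlin
    rw [one_mul] at h
    exact h
  have hevlin : ∀ (c : Fin D → k) (x : Fin (N + 1)), eval c (lin x) = (∑ i, c i • e i) x := by
    intro c x
    simp only [lin, map_sum, map_mul, eval_C, eval_X, Finset.sum_apply, Pi.smul_apply, smul_eq_mul]
    exact Finset.sum_congr rfl fun i _ => mul_comm _ _
  have hevQ : ∀ (c : Fin D → k) (l : Fin (N + 1 - D)),
      eval c (Q l) = ∑ j, uv l j * eval (∑ i, c i • e i) (pderiv j F) := by
    intro c l
    have hcomp : ∀ G : MvPolynomial (Fin (N + 1)) k, eval c (aeval lin G) = eval (∑ i, c i • e i) G := by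
      intro G
      have h := aeval_bind₁ c lin G
      rw [← aeval_eq_bind₁] at h
      simp only [aeval_eq_eval] at h
      rw [h]
      congr 2
      funext x
      exact hevlin c x
    change eval c (aeval lin (∑ j : Fin (N + 1), C (uv l j) * pderiv j F)) = _
    rw [hcomp, map_sum]
    exact Finset.sum_congr rfl fun j _ => by rw [map_mul, eval_C]
  -- a common non-zero zero `c`
  have hcard : Fintype.card (Fin (N + 1 - D)) < D := by rw [Fintype.card_fin]; omega
  obtain ⟨c, hc0, hc⟩ :=
    Literature.RingTheory.KrullDimension.exists_ne_zero_common_zero_of_isHomogeneous Q (fun _ => 2) hQ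
      (fun _ => two_pos) hcard
  let z : Fin (N + 1) → k := ∑ i, c i • e i
  have hzW : z ∈ W := by
    rw [← hspan]
    exact Submodule.sum_mem _ fun i _ => Submodule.smul_mem _ _ (Submodule.subset_span ⟨i, rfl⟩)
  have hz0 : z ≠ 0 := by
    intro hz
    apply hc0
    have h := (Fintype.linearIndependent_iff.1 he) c (by
      change ∑ i, c i • e i = 0
      exact hz)
    funext i; exact h i
  -- all directional derivatives of `F` at `z` vanish
  have hdirW : ∀ w ∈ W, ∑ j, w j * eval z (pderiv j F) = 0 := by
    intro w hw
    refine sum_mul_eval_pderiv_eq_zero_of_forall_eval_add_smul F z w fun t => hiso _ ?_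
    exact W.add_mem hzW (W.smul_mem t hw)
  have hdirU : ∀ l, ∑ j, uv l j * eval z (pderiv j F) = 0 := by
    intro l
    rw [← hevQ c l]
    exact hc l
  have hdir : ∀ v : Fin (N + 1) → k, ∑ j, v j * eval z (pderiv j F) = 0 := by
    intro v
    have hv : v ∈ W ⊔ W' := by rw [hWW'.sup_eq_top]; trivial
    obtain ⟨w, hw, w', hw', rfl⟩ := Submodule.mem_sup.1 hv
    rw [← huspan] at hw'
    obtain ⟨a, rfl⟩ := (Submodule.mem_span_range_iff_exists_fun k).1 hw'
    have hsplit : ∑ j, (w + ∑ l, a l • uv l) j * eval z (pderiv j F) =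
        ∑ j, w j * eval z (pderiv j F) + ∑ l, a l * ∑ j, uv l j * eval z (pderiv j F) := by
      simp only [Pi.add_apply, Finset.sum_apply, Pi.smul_apply, smul_eq_mul, add_mul,
        Finset.sum_add_distrib, Finset.sum_mul, Finset.mul_sum]
      rw [Finset.sum_comm]
      refine congrArg₂ _ rfl (Finset.sum_congr rfl fun l _ => Finset.sum_congr rfl fun j _ => by ring)
    rw [hsplit, hdirW w hw]
    simp only [hdirU, mul_zero, Finset.sum_const_zero, add_zero]
  refine ⟨z, hzW, hz0, fun j => ?_⟩
  have h := hdir (Pi.single j 1)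
  rw [Finset.sum_eq_single j (fun j' _ hj' => by rw [Pi.single_apply, if_neg hj', zero_mul])
    (fun hj => absurd (Finset.mem_univ j) hj), Pi.single_eq_same, one_mul] at h
  exact h

end Singular

/-! ### The non-isotropic plane pair -/

section Main

variable {F : MvPolynomial (Fin (N + 1)) k}

/-- **A smooth cubic in `ℙᴺ`, `N ≥ 12`, contains two planes meeting in a line whose span is a
`3`-plane NOT on the cubic.** For a cubic form `F` on `kᴺ⁺¹` (`k` algebraically closed, `N ≥ 12`)
whose gradient vanishes at no non-zero zero of `F`, there are linearly independent `a, b, y, w`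
with `F ≡ 0` on `span(a, b, y)` and on `span(a, b, w)` but `F(v) ≠ 0` for some
`v ∈ span(a, b, y, w)`. (Otherwise `exists_isotropic_of_noPair` gives an isotropic subspace of
dimension `N - 5 > (N + 1)/2`, carrying a singular zero by
`exists_ne_zero_pderiv_eval_eq_zero_of_isotropic`.) [cite: Mboro2018, Prop. 1.4 and proof of Thm. 1.3 (arXiv:1701.04488, p. 8)] [cite: Hartshorne1977, I Ex. 5.8] -/
theorem exists_nonIsotropic_plane_pair [IsAlgClosed k] (hN : 12 ≤ N) (hF : F.IsHomogeneous 3)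
    (hJ : ∀ z : Fin (N + 1) → k, z ≠ 0 → eval z F = 0 → ∃ j, eval z (pderiv j F) ≠ 0) :
    ∃ a b y w : Fin (N + 1) → k, LinearIndependent k ![a, b, y, w] ∧
      (∀ v ∈ Submodule.span k (Set.range ![a, b, y]), eval v F = 0) ∧
      (∀ v ∈ Submodule.span k (Set.range ![a, b, w]), eval v F = 0) ∧
      ∃ v ∈ Submodule.span k (Set.range ![a, b, y, w]), eval v F ≠ 0 := by
  by_contra hno
  push Not at hno
  have hpair : ∀ a b y w : Fin (N + 1) → k, LinearIndependent k ![a, b, y, w] →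
      (∀ v ∈ Submodule.span k (Set.range ![a, b, y]), eval v F = 0) →
      (∀ v ∈ Submodule.span k (Set.range ![a, b, w]), eval v F = 0) →
      ∀ v ∈ Submodule.span k (Set.range ![a, b, y, w]), eval v F = 0 :=
    fun a b y w h h₁ h₂ => hno a b y w h h₁ h₂
  obtain ⟨W, hW, hiso⟩ := exists_isotropic_of_noPair (by omega) hF hpair (D := N - 5) (by omega) (by omega)
  obtain ⟨z, hzW, hz0, hgrad⟩ := exists_ne_zero_pderiv_eval_eq_zero_of_isotropic hF hW hiso (by omega)
  obtain ⟨j, hj⟩ := hJ z hz0 (hiso z hzW)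
  exact hj (hgrad j)

end Main

end Literature.RingTheory.MvPolynomial

end
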